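import Literature.Analysis.Calculus.HadamardLemma
import Mathlib.Analysis.Calculus.BumpFunction.FiniteDimension
import HarnessLib

/-!
# Hadamard's lemma of first order in the last coordinate, with parameters

Topic `Literature/Analysis/Calculus`, continuing `HadamardLemma.lean` (smooth dependence of
interval integrals on parameters, `contDiff_intervalIntegral`).  For a function `g` on
`E' × ℝ` vanishing on the hyperplane `E' × {0}`:

* `lastQuot g (u, t) = ∫₀¹ ∂_t g (u, s t) ds` — the Hadamard quotient in the last coordinate;
  `eq_smul_lastQuot`: `g (u, t) = t • lastQuot g (u, t)` (fundamental theorem of calculus along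
  the segment `s ↦ (u, s t)`); `lastQuot_apply_zero`: `lastQuot g (u, 0) = ∂_t g (u, 0)`;
  `contDiff_lastQuot`: if `g` is `C^{n+1}` then `lastQuot g` is `Cⁿ` (`E'` finite-dimensional);
* `exists_local_lastQuot` — the localised form used chart by chart in Moser arguments near a
  hypersurface: if `g` is `C^∞` on `U' × ℝ` (`U'` open) and vanishes on `U' × {0}`, then near
  every `u₀ ∈ U'` there is a GLOBALLY `C^∞` function `ĝ` with `g (u, t) = t • ĝ (u, t)` for `u`
  near `u₀` and all `t`, and `ĝ (u, 0) = ∂_t g (u, 0)` (cut `g` off in `u` by a smooth bump).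

Standard real analysis (Hadamard's lemma; e.g. the first step of the proof of the Morse lemma,
Milnor, *Morse theory* (1963), Lemma 2.1). [folklore]  Everything here is proved.
-/

noncomputable section

open Set Function Filter MeasureTheory intervalIntegral Metric
open scoped Topology ContDiff

namespace Literature.Analysis.Calculus

variable {E' G : Type*} [NormedAddCommGroup E'] [NormedSpace ℝ E'] [NormedAddCommGroup G]
  [NormedSpace ℝ G]

/-- **The Hadamard quotient in the last coordinate**: `lastQuot g (u, t) = ∫₀¹ ∂_t g (u, s t) ds`.
[folklore] -/
def lastQuot (g : E' × ℝ → G) (x : E' × ℝ) : G :=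
  ∫ s in (0 : ℝ)..1, fderiv ℝ g (x.1, s * x.2) ((0 : E'), (1 : ℝ))

/-- At `t = 0` the quotient is the `t`-derivative. [folklore] -/
theorem lastQuot_apply_zero [CompleteSpace G] (g : E' × ℝ → G) (u : E') :
    lastQuot g (u, 0) = fderiv ℝ g (u, 0) ((0 : E'), (1 : ℝ)) := by
  simp [lastQuot]

/-- **Hadamard's lemma in the last coordinate**: if `g` is `C¹` and vanishes on `E' × {0}` then
`g (u, t) = t • lastQuot g (u, t)`. [folklore] -/
theorem eq_smul_lastQuot [CompleteSpace G] {g : E' × ℝ → G} (hg : ContDiff ℝ 1 g)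
    (h0 : ∀ u, g (u, 0) = 0) (x : E' × ℝ) : g x = x.2 • lastQuot g x := by
  -- the segment `φ s = g (x.1, s * x.2)` and its derivative
  have hγ : ∀ s : ℝ, HasDerivAt (fun s : ℝ => ((x.1, s * x.2) : E' × ℝ)) ((0 : E'), x.2) s := by
    intro s
    have h := (hasDerivAt_const s x.1).prodMk ((hasDerivAt_id s).mul_const x.2)
    simpa using h
  have hφ : ∀ s : ℝ, HasDerivAt (fun s : ℝ => g (x.1, s * x.2))
      (x.2 • fderiv ℝ g (x.1, s * x.2) ((0 : E'), (1 : ℝ))) s := by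
    intro s
    have hd : HasFDerivAt g (fderiv ℝ g (x.1, s * x.2)) (x.1, s * x.2) :=
      ((hg.differentiable one_ne_zero) _).hasFDerivAt
    have h := hd.comp_hasDerivAt s (hγ s)
    refine h.congr_deriv ?_
    have : ((0 : E'), x.2) = x.2 • (((0 : E'), (1 : ℝ)) : E' × ℝ) := by
      ext <;> simp
    rw [this, map_smul]
  have hcont : Continuous fun s : ℝ => x.2 • fderiv ℝ g (x.1, s * x.2) ((0 : E'), (1 : ℝ)) := by
    refine continuous_const.smul ?_
    exact ((hg.continuous_fderiv one_ne_zero).comp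
      (continuous_const.prodMk (continuous_id.mul continuous_const))).clm_apply continuous_const
  have hint := integral_eq_sub_of_hasDerivAt (fun s _ => hφ s) (hcont.intervalIntegrable 0 1)
  simp only [one_mul, zero_mul, h0, sub_zero] at hint
  rw [← hint, intervalIntegral.integral_smul]
  rfl

/-- **The Hadamard quotient of a `C^{n+1}` function is `Cⁿ`** (smooth dependence of the integral on
the parameters, `contDiff_intervalIntegral`). [folklore] -/
theorem contDiff_lastQuot [FiniteDimensional ℝ E'] [CompleteSpace G] {g : E' × ℝ → G} {n : ℕ∞}
    (hg : ContDiff ℝ ((n + 1 : ℕ∞) : WithTop ℕ∞) g) : ContDiff ℝ n (lastQuot g) := by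
  have h1 : ContDiff ℝ n (fderiv ℝ g) := hg.fderiv_right (by exact_mod_cast le_rfl)
  have h2 : ContDiff ℝ n (fun p : (E' × ℝ) × ℝ => ((p.1.1, p.2 * p.1.2) : E' × ℝ)) :=
    (contDiff_fst.comp contDiff_fst).prodMk (contDiff_snd.mul (contDiff_snd.comp contDiff_fst))
  have h3 : ContDiff ℝ n (uncurry fun (x : E' × ℝ) (s : ℝ) =>
      fderiv ℝ g (x.1, s * x.2) ((0 : E'), (1 : ℝ))) :=
    (h1.comp h2).clm_apply contDiff_const
  exact contDiff_intervalIntegral h3 0 1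

/-- A smooth bump equal to `1` near `u₀` with support inside an open `U' ∋ u₀`
(`E'` finite-dimensional). [folklore] -/
theorem exists_contDiff_bump_nhds [FiniteDimensional ℝ E'] {U' : Set E'} (hU : IsOpen U') {u₀ : E'}
    (hu₀ : u₀ ∈ U') :
    ∃ ρ : E' → ℝ, ContDiff ℝ ∞ ρ ∧ tsupport ρ ⊆ U' ∧ ∀ᶠ u in 𝓝 u₀, ρ u = 1 := by
  obtain ⟨ε, hε, hball⟩ := Metric.isOpen_iff.1 hU u₀ hu₀
  let f : ContDiffBump u₀ := ⟨ε / 4, ε / 2, by positivity, by linarith⟩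
  refine ⟨f, f.contDiff, ?_, ?_⟩
  · rw [f.tsupport_eq]
    exact (closedBall_subset_ball (by show ε / 2 < ε; linarith)).trans hball
  · filter_upwards [Metric.ball_mem_nhds u₀ (show (0 : ℝ) < ε / 4 by positivity)] with u hu
    exact f.one_of_mem_closedBall (ball_subset_closedBall hu)

/-- **Localised Hadamard division in the last coordinate.** If `g` is `C^∞` on `U' × ℝ` (`U'`
open in the finite-dimensional `E'`) and vanishes on `U' × {0}`, then near every `u₀ ∈ U'` there
is a globally `C^∞` function `ĝ` with `g (u, t) = t • ĝ (u, t)` for all `u` near `u₀` and all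
`t`, and `ĝ (u, 0) = ∂_t g (u, 0)` there. [folklore] -/
theorem exists_local_lastQuot [FiniteDimensional ℝ E'] [CompleteSpace G] {g : E' × ℝ → G}
    {U' : Set E'} (hU : IsOpen U') (hg : ContDiffOn ℝ ∞ g (U' ×ˢ univ))
    (h0 : ∀ u ∈ U', g (u, 0) = 0) {u₀ : E'} (hu₀ : u₀ ∈ U') :
    ∃ ĝ : E' × ℝ → G, ContDiff ℝ ∞ ĝ ∧ (∀ᶠ u in 𝓝 u₀, ∀ t, g (u, t) = t • ĝ (u, t)) ∧
      ∀ᶠ u in 𝓝 u₀, ĝ (u, 0) = fderiv ℝ g (u, 0) ((0 : E'), (1 : ℝ)) := by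
  obtain ⟨ρ, hρ, hρU, hρ1⟩ := exists_contDiff_bump_nhds hU hu₀
  -- the cut-off function `g' = (ρ ∘ fst) • g`, globally smooth
  set g' : E' × ℝ → G := fun x => ρ x.1 • g x with hg'
  have hsm : ContDiff ℝ ∞ g' := by
    rw [contDiff_iff_contDiffAt]
    intro x
    by_cases hx : x.1 ∈ U'
    · have hgx : ContDiffAt ℝ ∞ g x :=
        hg.contDiffAt ((hU.prod isOpen_univ).mem_nhds ⟨hx, mem_univ _⟩)
      exact ((hρ.comp contDiff_fst).contDiffAt).smul hgx
    · have hx' : x.1 ∉ tsupport ρ := fun h => hx (hρU h)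
      have hev : g' =ᶠ[𝓝 x] fun _ => 0 := by
        have ho : IsOpen ((tsupport ρ)ᶜ ×ˢ (univ : Set ℝ)) :=
          (isClosed_tsupport ρ).isOpen_compl.prod isOpen_univ
        filter_upwards [ho.mem_nhds ⟨hx', mem_univ _⟩] with y hy
        show ρ y.1 • g y = 0
        rw [image_eq_zero_of_notMem_tsupport hy.1, zero_smul]
      exact (contDiffAt_const (c := (0 : G))).congr_of_eventuallyEq hev
  have h0' : ∀ u, g' (u, 0) = 0 := by
    intro u
    by_cases hu : u ∈ U'
    · show ρ u • g (u, 0) = 0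
      rw [h0 u hu, smul_zero]
    · show ρ u • g (u, 0) = 0
      rw [image_eq_zero_of_notMem_tsupport (fun h => hu (hρU h)), zero_smul]
  refine ⟨lastQuot g', ?_, ?_, ?_⟩
  · have h : ContDiff ℝ (((⊤ : ℕ∞) + 1 : ℕ∞) : WithTop ℕ∞) g' := by
      rw [show ((⊤ : ℕ∞) + 1 : ℕ∞) = ⊤ from top_add 1]
      exact hsm
    exact contDiff_lastQuot h
  · filter_upwards [hρ1] with u hu t
    have h := eq_smul_lastQuot (hsm.of_le (by exact_mod_cast le_top)) h0' (u, t)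
    have hgg : g' (u, t) = g (u, t) := by
      show ρ u • g (u, t) = g (u, t)
      rw [hu, one_smul]
    rw [← hgg]
    exact h
  · obtain ⟨O, hO, hOo, hu₀O⟩ := _root_.eventually_nhds_iff.1 hρ1
    filter_upwards [hOo.mem_nhds hu₀O] with u hu
    rw [lastQuot_apply_zero]
    have hev : g' =ᶠ[𝓝 ((u, (0 : ℝ)) : E' × ℝ)] g := by
      filter_upwards [(hOo.prod isOpen_univ).mem_nhds ⟨hu, mem_univ _⟩] with y hy
      show ρ y.1 • g y = g y
      rw [hO y.1 hy.1, one_smul]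
    rw [hev.fderiv_eq]

end Literature.Analysis.Calculus

end
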